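import Summits.QuantumFields.YangMills.Theorems.BalabanUVNodesN12FlatHndRecordLetters
import Literature.MathematicalPhysics.QuantumFieldTheory.Balaban1983to89.B14Eq213DetSet
import Literature.MathematicalPhysics.QuantumFieldTheory.Balaban1983to89.B6CubeRightLegsV1
import Literature.MathematicalPhysics.QuantumFieldTheory.BalabanImbrieJaffe1984to88.BIJ88RT51Background
import Summits.QuantumFields.YangMills.Theorems.UnitScaleTiltProp7FlatHolonomy
import HarnessLib

/-!
# BalabanUVNodes ∕ N12 — (β)♭: THE CONNECTIVITY LETTER (C) DISCHARGED for the record's determining sets `𝐁_k(Z) = B14.Eq213DetSet.Bj M₁ Z k` ([III] (2.13)), and the flat real `hnondeg` letter on the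
# `𝐁_k(Z)`-adapted hierarchical axial slice with ALL FOUR geometric letters (L) (Cov) (F) (C) discharged (only «one lattice line per direction misses `Z`» is kept, for (L))

Cell `pub-ymgap` (HUMAN RULINGS D-0062 ∕ D-0149), WIDTH SEAT `pub-ymgap-dag-n12-w3` g2 (node N12 = [B15]; key K1⁷ `stmt-QuantumFields-20542`, `--supports … --as helper`; count-neutral).  THEOREMS ONLY.
Letter (C) of `N12FlatFibreNullSpaceDetSet.exists_constrGauge_of_plaq_eq_zero_of_iterLin_eq_zero_detSet` ∕ `N12FlatHierAxialHndDetSet.grad_eq_zero_of_hierAxial_of_locConst`: «a fine site function `ψ`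
constant along every constrained bond of `𝐁` (read at the `j`-fold centres, all levels `j ≤ k`) takes ONE value at the sources of any two constrained bonds».

THE MECHANISM (NODE 00 geometry of the maximal sequence `Ω₁ ⊇ Ω₂ ⊇ ⋯ ⊇ Ω_k`, `Ω_n` a union of `n`-blocks): the last scale `n(z) = max{i ≤ k : z ∈ Ω_i}` (`0` off `Ω₁`) of a fine site `z`, its TOP
`iterBlockOf n(z) z ∈ Γ_{n(z)}` (a member site, §3), and the potential `T(z) = ψ(centre of the top of z)`.  ★★ `T_shift_eq` (§4): `T(z + e_μ) = T(z)` for EVERY fine bond — equal last scales: the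
two tops are equal or adjacent member blocks (one constrained bond); last scales `a < a'`: the `a'`-block `Y ∋ z` is disjoint from `Ω_{a'}`, adjacent to the member block of `z + e_μ` (one
constrained bond at level `a'`, reaching the OUTER neighbour `Y`), the centre of `Y` is its own top, and `T` is constant on `Y` by in-block connectivity (§1 `blockConst_of_adjacent`: walk to
the block's top corner) and the induction hypothesis at smaller scales.  Hence `T` is constant on the torus (`N12FlatFibreNullSpace.const_of_shift_eq`) and every constrained source value
of `ψ` is a value of `T`: ★★★ `hconn_Bj` (§5).  §6 ★★ `hnondeg_real_flat_hierAxial_Bj`: `N12FlatHndRecordLetters.hnondeg_real_flat_hierAxial_detSet` at `𝐁 = 𝐁_k(Z)` with (L) from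
`hloop_Bj_of_line_misses`, (Cov) from `hcov_Bj`, (C) from `hconn_Bj` — hypotheses left: `1 ≤ M₁`, `1 ≤ k ≤ m + K`, cover divisibility `L^k·M₁ ∣ sitesPerDir 0`, one line per direction missing `Z`.

CONTENTS.  §1 `val_shift_and_iterBlockOf_eq`, ★ `blockConst_of_adjacent`; §2 `mem_iff_centre_mem`, `exists_embIter_eq_embIter_of_le`, `embIter_iterBlockOf_embIter`; §3 `mem_maxDomT_of_findGreatest_eq`,
`not_mem_maxDomT_of_findGreatest_lt`, `embIter_mem_maxDomT_of_mem_Bj`, ★ `iterBlockOf_mem_Bj_of_findGreatest_eq`, `findGreatest_embIter_of_mem_Bj`, `findGreatest_lt_of_block_disjoint`; §4 `T_eq_of_findGreatest_eq`,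
`T_embIter_of_mem_Bj`, `T_centre_of_block_disjoint`, ★★ `T_shift_eq`; §5 ★★★ `hconn_Bj`; §6 ★★ `hnondeg_real_flat_hierAxial_Bj`.

HONEST FRAMING.  Pure lattice geometry ∕ linear algebra at the FLAT configuration; the four geometric letters of this seat's (β)♭ files are now theorems for `Bj M₁ Z k` ((L) under the line-miss
hypothesis); what remains DISPLAYED in §6 is analytic: the kernel letter `hker`, the bilinear Hessian hypothesis `hq`, the `Q`-recursion data — and, upstream, `honto` for the `𝐁`-adapted slice, the
near-flat backgrounds `U₀ ≠ 1`, the complexification.  Nothing of Bałaban's estimates is asserted; N12 NOT discharged; K1⁷ NOT closed; counts unmoved (typed 28∕28 · discharged 5∕27); one finite 𝕋⁴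
programme at fixed ε — R4 closes the conditional rung `BalabanLadder.UV` only; the Yang–Mills mass gap (Clay) is NOT proved by any of this; nothing continuum ∕ ℝ⁴ ∕ OS.
-/

noncomputable section

namespace Summit.QuantumFields.YangMills.BalabanUVNodes.N12FlatHndConnLetter

open scoped BigOperators
open Literature.MathematicalPhysics.QuantumFieldTheory.Balaban1983to89
open B15DeterminingSets
open B5Eq118OneStroke (iterBlockOf iterBlockOf_succ val_iterBlockOf)
open Literature.MathematicalPhysics.QuantumFieldTheory.Balaban1983to89.B14.Eq213DetSet
  (Bj Bj_zero Bj_mid Bj_top maxDomT maxDomT_subset maxDomT_antitone isBlockUnion_maxDomT)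
open Literature.MathematicalPhysics.QuantumFieldTheory.Balaban1983to89.B14.Eq213MaximalDomains (side)
open Literature.MathematicalPhysics.QuantumFieldTheory.Balaban1983to89.B14.Eq22Determines (IsBlockUnion)
open Literature.MathematicalPhysics.QuantumFieldTheory.BalabanImbrieJaffe1984to88.BIJ88RT51Background (iterBlockOf_embIter)
open B6CubeRightLegsV1 (iterBlockOf_shift_or)
open Summit.QuantumFields.YangMills.Theorems.Prop7FlatHolonomy (sitesPerDir_zero_eq_mul_pow)

variable {P : Params}

/-! ## §1 In-block connectivity of the fine sites of one block -/

/-- A fine unit step that does not leave the `i`-block in its direction: if the block-local `μ`-coordinate of `z` is not maximal, `z + e_μ` has `μ`-label `+1` (no wrap) and the same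
`i`-block. [cite: Balaban1987RG1, (0.1)-(0.3) pp.251-252] -/
theorem val_shift_and_iterBlockOf_eq {i : ℕ} (hi : i ≤ P.m + P.K) (z : Site P 0) (μ : Fin P.d) (h : (z μ).val % P.L ^ i < P.L ^ i - 1) :
    ((z.shift μ) μ).val = (z μ).val + 1 ∧ iterBlockOf i (z.shift μ) = iterBlockOf i z := by
  have hLi : 0 < P.L ^ i := pow_pos P.L_pos i
  have hN0 : P.sitesPerDir 0 = P.sitesPerDir i * P.L ^ i := sitesPerDir_zero_eq_mul_pow hi
  -- no wrap: `(z μ).val + 1 < N₀`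
  have hq : (z μ).val / P.L ^ i < P.sitesPerDir i := by rw [Nat.div_lt_iff_lt_mul hLi, ← hN0]; exact ZMod.val_lt _
  have hlt : (z μ).val + 1 < P.sitesPerDir 0 := by
    have h2 := Nat.mul_le_mul_right (P.L ^ i) (show (z μ).val / P.L ^ i + 1 ≤ P.sitesPerDir i from hq)
    have := Nat.div_add_mod' (z μ).val (P.L ^ i); have := Nat.mod_lt (z μ).val hLi; rw [Nat.add_mul, one_mul] at h2; omega
  have hval : ((z.shift μ) μ).val = (z μ).val + 1 := by
    simp only [Site.shift, Function.update_self]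
    rw [ZMod.val_add, ZMod.val_one, Nat.mod_eq_of_lt hlt]
  refine ⟨hval, funext fun ν => ZMod.val_injective _ ?_⟩
  rw [val_iterBlockOf i hi, val_iterBlockOf i hi]
  by_cases hν : ν = μ
  · subst hν
    rw [hval]  -- `(a+1)/b = a/b` when `a % b < b - 1`
    have hdecomp := Nat.div_add_mod (z ν).val (P.L ^ i)
    set a := (z ν).val
    set b := P.L ^ i
    have h1 : a + 1 = b * (a / b) + (a % b + 1) := by omega
    have h0 : (a % b + 1) / b = 0 := Nat.div_eq_of_lt (by omega)
    rw [h1, Nat.mul_add_div hLi, h0, add_zero]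
  · rw [show (z.shift μ) ν = z ν by simp [Site.shift, Function.update_of_ne hν]]

/-- **IN-BLOCK CONNECTIVITY**: a function on fine sites that agrees across every unit step INSIDE the `i`-block `W` is constant on `W` (walk to the top corner of the block, one coordinate
unit at a time). [cite: Balaban1987RG1, (0.1)-(0.3) pp.251-252] -/
theorem blockConst_of_adjacent {V : Type*} {i : ℕ} (hi : i ≤ P.m + P.K) (W : Site P i) (T : Site P 0 → V)
    (hadj : ∀ (z : Site P 0) (μ : Fin P.d), iterBlockOf i z = W → iterBlockOf i (z.shift μ) = W → T (z.shift μ) = T z)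
    {z z' : Site P 0} (hz : iterBlockOf i z = W) (hz' : iterBlockOf i z' = W) : T z = T z' := by
  classical
  have hLi : 0 < P.L ^ i := pow_pos P.L_pos i
  -- the defect to the top corner
  let D : Site P 0 → ℕ := fun x => ∑ ν : Fin P.d, (P.L ^ i - 1 - (x ν).val % P.L ^ i)
  -- labels inside the block: `x_ν = W_ν·L^i + x_ν % L^i`
  have hlab : ∀ x : Site P 0, iterBlockOf i x = W → ∀ ν, (x ν).val = (W ν).val * P.L ^ i + (x ν).val % P.L ^ i := by
    intro x hx ν
    have h := congrArg (fun y : Site P i => (y ν).val) hx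
    simp only [val_iterBlockOf i hi] at h
    have := Nat.div_add_mod (x ν).val (P.L ^ i)
    rw [h, Nat.mul_comm] at this; exact this.symm
  -- every site of the block reaches the top corner
  have hreach : ∀ (d : ℕ) (x : Site P 0), D x = d → iterBlockOf i x = W →
      T x = T (fun ν => (((W ν).val * P.L ^ i + (P.L ^ i - 1) : ℕ) : ZMod (P.sitesPerDir 0))) := by
    intro d
    induction d with
    | zero =>
      intro x hD hx
      -- all local coordinates maximal: `x` IS the corner
      have hall : ∀ ν, (x ν).val % P.L ^ i = P.L ^ i - 1 := fun ν => by
        have hle : (x ν).val % P.L ^ i ≤ P.L ^ i - 1 := Nat.le_sub_one_of_lt (Nat.mod_lt _ hLi)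
        have hterm : P.L ^ i - 1 - (x ν).val % P.L ^ i = 0 := Finset.sum_eq_zero_iff.1 hD ν (Finset.mem_univ ν)
        omega
      congr 1; funext ν
      rw [← ZMod.natCast_zmod_val (x ν), hlab x hx ν, hall ν]
    | succ d ih =>
      intro x hD hx
      -- some local coordinate is not maximal
      obtain ⟨ν, hν⟩ : ∃ ν, (x ν).val % P.L ^ i < P.L ^ i - 1 := by
        by_contra hcon
        have : D x = 0 := Finset.sum_eq_zero fun ν _ => by
          have hle : (x ν).val % P.L ^ i ≤ P.L ^ i - 1 := Nat.le_sub_one_of_lt (Nat.mod_lt _ hLi)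
          have : ¬ (x ν).val % P.L ^ i < P.L ^ i - 1 := fun h => hcon ⟨ν, h⟩
          omega
        omega
      obtain ⟨hval, hblk⟩ := val_shift_and_iterBlockOf_eq hi x ν hν
      have hxW : iterBlockOf i (x.shift ν) = W := hblk.trans hx
      -- the defect drops by one
      have hmodν : ((x.shift ν) ν).val % P.L ^ i = (x ν).val % P.L ^ i + 1 := by
        rw [hval]
        have hdecomp := Nat.div_add_mod (x ν).val (P.L ^ i)
        have h1 : (x ν).val + 1 = P.L ^ i * ((x ν).val / P.L ^ i) + ((x ν).val % P.L ^ i + 1) := by omega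
        rw [h1, Nat.mul_add_mod, Nat.mod_eq_of_lt (by omega)]
      have hD' : D (x.shift ν) = d := by
        have hsplit : ∀ y : Site P 0, D y = (P.L ^ i - 1 - (y ν).val % P.L ^ i) + ∑ κ ∈ Finset.univ.erase ν, (P.L ^ i - 1 - (y κ).val % P.L ^ i) :=
          fun y => (Finset.add_sum_erase _ _ (Finset.mem_univ ν)).symm
        have hrest : ∑ κ ∈ Finset.univ.erase ν, (P.L ^ i - 1 - ((x.shift ν) κ).val % P.L ^ i) =
            ∑ κ ∈ Finset.univ.erase ν, (P.L ^ i - 1 - (x κ).val % P.L ^ i) :=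
          Finset.sum_congr rfl fun κ hκ => by rw [show (x.shift ν) κ = x κ by simp [Site.shift, Function.update_of_ne (Finset.ne_of_mem_erase hκ)]]
        have hx0 := hsplit x
        rw [hsplit (x.shift ν), hrest, hmodν]
        omega
      rw [← hadj x ν hx hxW]
      exact ih (x.shift ν) hD' hxW
  rw [hreach (D z) z rfl hz, hreach (D z') z' rfl hz']

/-! ## §2 Block bookkeeping: centres, block unions -/

/-- Membership in a union of `n`-blocks is read at the centre of the `n`-block. [cite: Balaban1988Convergent, (2.1) p.255] -/
theorem mem_iff_centre_mem {n : ℕ} {X : Set (Site P 0)} (hX : IsBlockUnion n X) (z : Site P 0) :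
    z ∈ X ↔ embIter n (iterBlockOf n z) ∈ X := by
  rw [← N12FlatHndRecordLetters.blockIter_eq_iterBlockOf]; exact hX z

/-- A `j'`-fold centre is a `j`-fold centre for `j ≤ j'`. [cite: Balaban1987RG1, (0.1) p.251] -/
theorem exists_embIter_eq_embIter_of_le {j : ℕ} : ∀ {j' : ℕ}, j ≤ j' → ∀ Y : Site P j', ∃ E : Site P j, embIter j' Y = embIter j E := by
  intro j' hjj' Y
  obtain ⟨e, rfl⟩ : ∃ e, j' = j + e := ⟨j' - j, by omega⟩
  clear hjj'
  induction e with
  | zero => exact ⟨Y, rfl⟩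
  | succ e ih => obtain ⟨E, hE⟩ := ih (emb Y); exact ⟨E, by rw [show embIter (j + (e + 1)) Y = embIter (j + e) (emb Y) from rfl, hE]⟩

/-- The `j`-block of a `j'`-fold centre has that centre as its own centre (`j ≤ j' `, `j ≤ m + K`). [cite: Balaban1987RG1, (0.1) p.251] -/
theorem embIter_iterBlockOf_embIter {j j' : ℕ} (hj : j ≤ P.m + P.K) (hjj' : j ≤ j') (Y : Site P j') :
    embIter j (iterBlockOf j (embIter j' Y)) = embIter j' Y := by
  obtain ⟨E, hE⟩ := exists_embIter_eq_embIter_of_le hjj' Y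
  rw [hE, iterBlockOf_embIter j hj E]

/-! ## §3 The last scale `n(z)` of a fine site and its top (a member site of `𝐁_k(Z)`) -/

open scoped Classical

section Record

variable {M₁ : ℕ} {Z : Set (Site P 0)} {k : ℕ}

/-- The last scale `n(z) = max{i ≤ k : z ∈ Ω_i}` (`0` if `z ∉ Ω₁`): `z ∈ Ω_{n(z)}` when `n(z) ≥ 1`. [cite: Balaban1988Convergent, (2.13) pp.256-257] -/
theorem mem_maxDomT_of_findGreatest_eq (z : Site P 0) {a : ℕ} (ha : Nat.findGreatest (fun i => z ∈ maxDomT M₁ Z i) k = a) (h1 : 1 ≤ a) :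
    z ∈ maxDomT M₁ Z a :=
  (Nat.findGreatest_eq_iff.1 ha).2.1 (by omega)

/-- Above the last scale the site is outside: `n(z) < i ≤ k ⟹ z ∉ Ω_i`. [cite: Balaban1988Convergent, (2.13) pp.256-257] -/
theorem not_mem_maxDomT_of_findGreatest_lt (z : Site P 0) {a i : ℕ} (ha : Nat.findGreatest (fun i => z ∈ maxDomT M₁ Z i) k = a) (hai : a < i) (hik : i ≤ k) :
    z ∉ maxDomT M₁ Z i :=
  (Nat.findGreatest_eq_iff.1 ha).2.2 hai hik

/-- The centre of a member site of positive scale `n ≤ k` lies in `Ω_n`. [cite: Balaban1988Convergent, (2.13) pp.256-257] -/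
theorem embIter_mem_maxDomT_of_mem_Bj {n : ℕ} (hpos : 0 < n) (hn : n ≤ k) {y : Site P n} (hy : y ∈ (Bj M₁ Z k : DetSet P) n) :
    embIter n y ∈ maxDomT M₁ Z n := by
  rcases hn.lt_or_eq with hlt | rfl
  · rw [Bj_mid hpos hlt] at hy; exact mem_pts.1 hy.1
  · rw [Bj_top] at hy; exact mem_pts.1 hy

variable (hM : 1 ≤ M₁) (hk : 1 ≤ k) (hkK : k ≤ P.m + P.K) (hdiv : side P.L M₁ k ∣ P.sitesPerDir 0)
include hM hk hkK hdiv

/-- **THE TOP OF A FINE SITE IS A MEMBER SITE**: with `a = n(z)`, the `a`-block of `z` belongs to `Γ_a` of `𝐁_k(Z)`. [cite: Balaban1988Convergent, (2.2) p.255, (2.13) pp.256-257] -/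
theorem iterBlockOf_mem_Bj_of_findGreatest_eq (z : Site P 0) {a : ℕ} (ha : Nat.findGreatest (fun i => z ∈ maxDomT M₁ Z i) k = a) :
    iterBlockOf a z ∈ (Bj M₁ Z k : DetSet P) a := by
  have hak : a ≤ k := ha ▸ Nat.findGreatest_le k
  rcases Nat.eq_zero_or_pos a with rfl | hpos
  · rw [Bj_zero hk, B5Eq118OneStroke.iterBlockOf_zero]
    exact not_mem_maxDomT_of_findGreatest_lt z ha Nat.zero_lt_one hk
  · have hctr : embIter a (iterBlockOf a z) ∈ maxDomT M₁ Z a :=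
      (mem_iff_centre_mem (isBlockUnion_maxDomT hM hdiv hpos hak (hak.trans hkK)) z).1 (mem_maxDomT_of_findGreatest_eq z ha hpos)
    rcases hak.lt_or_eq with hlt | rfl
    · rw [Bj_mid hpos hlt]
      refine ⟨mem_pts.2 hctr, fun hmem => ?_⟩
      have hz1 : z ∈ maxDomT M₁ Z (a + 1) :=
        (mem_iff_centre_mem (B14.Eq213DetSet.isBlockUnion_maxDomT_succ hM hdiv (show a + 1 ≤ k from hlt) (hak.trans hkK)) z).2 (mem_pts.1 hmem)
      exact not_mem_maxDomT_of_findGreatest_lt z ha (Nat.lt_succ_self a) hlt hz1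
    · rw [Bj_top]
      exact mem_pts.2 hctr

omit hkK hdiv in
/-- **THE LAST SCALE OF A MEMBER CENTRE IS ITS OWN SCALE**: for `y ∈ Γ_j` (`j ≤ k`), `n(embIter j y) = j`. [cite: Balaban1988Convergent, (2.2) p.255, (2.13) pp.256-257] -/
theorem findGreatest_embIter_of_mem_Bj {j : ℕ} (hj : j ≤ k) {y : Site P j} (hy : y ∈ (Bj M₁ Z k : DetSet P) j) :
    Nat.findGreatest (fun i => embIter j y ∈ maxDomT M₁ Z i) k = j := by
  rw [Nat.findGreatest_eq_iff]
  rcases Nat.eq_zero_or_pos j with rfl | hpos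
  · rw [Bj_zero hk] at hy
    exact ⟨hj, fun h => (h rfl).elim, fun n hn hnk hmem => hy (maxDomT_antitone hM Z (show 1 ≤ n by omega) hmem)⟩
  · rcases hj.lt_or_eq with hlt | rfl
    · rw [Bj_mid hpos hlt] at hy
      obtain ⟨hin, hout⟩ := hy
      exact ⟨hj, fun _ => mem_pts.1 hin, fun n hn hnk hmem => hout (mem_pts.2 (maxDomT_antitone hM Z (show j + 1 ≤ n by omega) hmem))⟩
    · rw [Bj_top] at hy
      exact ⟨le_rfl, fun _ => mem_pts.1 hy, fun n hn hnk => absurd hnk (by omega)⟩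

omit hk in
/-- Inside a `j`-block disjoint from `Ω_j` (`1 ≤ j ≤ k`) every fine site has last scale `< j`. [cite: Balaban1988Convergent, (2.13) pp.256-257] -/
theorem findGreatest_lt_of_block_disjoint {j : ℕ} (hj1 : 1 ≤ j) (hj : j ≤ k) {Y : Site P j} (hY : embIter j Y ∉ maxDomT M₁ Z j)
    {z : Site P 0} (hz : iterBlockOf j z = Y) : Nat.findGreatest (fun i => z ∈ maxDomT M₁ Z i) k < j := by
  refine Nat.lt_of_not_le fun hge => hY ?_
  set a := Nat.findGreatest (fun i => z ∈ maxDomT M₁ Z i) k with ha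
  have hzj : z ∈ maxDomT M₁ Z j := maxDomT_antitone hM Z hge (mem_maxDomT_of_findGreatest_eq z ha.symm (hj1.trans hge))
  exact hz ▸ (mem_iff_centre_mem (isBlockUnion_maxDomT hM hdiv hj1 hj (hj.trans hkK)) z).1 hzj

end Record

/-! ## §4 The potential `T` read at the tops, and its continuity across every fine bond -/

section Main

variable {V : Type*} {M₁ : ℕ} {Z : Set (Site P 0)} {k : ℕ}
variable (hM : 1 ≤ M₁) (hk : 1 ≤ k) (hkK : k ≤ P.m + P.K) (hdiv : side P.L M₁ k ∣ P.sitesPerDir 0)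
variable (ψ : Site P 0 → V) (T : Site P 0 → V)  -- the site function; the potential `T(z) = ψ(embIter n(z) (iterBlockOf n(z) z))`, kept abstract through `hT`
variable (hT : ∀ z, T z = ψ (embIter (Nat.findGreatest (fun i => z ∈ maxDomT M₁ Z i) k) (iterBlockOf (Nat.findGreatest (fun i => z ∈ maxDomT M₁ Z i) k) z)))
include hT

/-- Reading `T` at a prescribed last scale. [cite: Balaban1988Convergent, (2.13) pp.256-257 (bookkeeping)] -/
theorem T_eq_of_findGreatest_eq (z : Site P 0) {a : ℕ} (ha : Nat.findGreatest (fun i => z ∈ maxDomT M₁ Z i) k = a) :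
    T z = ψ (embIter a (iterBlockOf a z)) := by
  rw [hT z]; cases ha; rfl

include hM hk hkK hdiv

omit hdiv in
/-- `T` at a member centre is `ψ` there. [cite: Balaban1988Convergent, (2.2) p.255] -/
theorem T_embIter_of_mem_Bj {j : ℕ} (hj : j ≤ k) {y : Site P j} (hy : y ∈ (Bj M₁ Z k : DetSet P) j) : T (embIter j y) = ψ (embIter j y) := by
  rw [T_eq_of_findGreatest_eq ψ T hT _ (findGreatest_embIter_of_mem_Bj hM hk hj hy), iterBlockOf_embIter j (hj.trans hkK)]

omit hk in
/-- `T` at the centre of a `j`-block disjoint from `Ω_j` is `ψ` there (the centre is its own top). [cite: Balaban1988Convergent, (2.13) pp.256-257] -/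
theorem T_centre_of_block_disjoint {j : ℕ} (hj1 : 1 ≤ j) (hj : j ≤ k) {Y : Site P j} (hY : embIter j Y ∉ maxDomT M₁ Z j) :
    T (embIter j Y) = ψ (embIter j Y) := by
  set a := Nat.findGreatest (fun i => embIter j Y ∈ maxDomT M₁ Z i) k with ha
  have halt : a < j := findGreatest_lt_of_block_disjoint hM hkK hdiv hj1 hj hY (iterBlockOf_embIter j (hj.trans hkK) Y)
  rw [T_eq_of_findGreatest_eq ψ T hT _ ha.symm, embIter_iterBlockOf_embIter (by omega) halt.le Y]

/-- ★★ **CONTINUITY OF `T` ACROSS EVERY FINE BOND**, given constancy of `ψ` along the constrained bonds of `𝐁_k(Z)`: by strong induction on the larger of the two last scales; the equal-scale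
case is one constrained bond between adjacent member blocks, the unequal case one constrained bond at the higher scale (its lower end block is disjoint from that domain, adjacent to a member
block) plus constancy of `T` on that lower block (in-block connectivity at smaller scales). [cite: Balaban1988Convergent, (2.2) p.255, (2.13) pp.256-257] -/
theorem T_shift_eq (hψ : ∀ j, j ≤ k → ∀ c ∈ bondsOf ((Bj M₁ Z k : DetSet P) j), ψ (embIter j c.tgt) = ψ (embIter j c.src)) :
    ∀ (i : ℕ) (z : Site P 0) (μ : Fin P.d), Nat.findGreatest (fun i => z ∈ maxDomT M₁ Z i) k < i →
      Nat.findGreatest (fun i => z.shift μ ∈ maxDomT M₁ Z i) k < i → T (z.shift μ) = T z := by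
  intro i
  induction i using Nat.strong_induction_on with | _ i ih => ?_
  intro z μ hzi hz'i
  -- constancy of `T` on every `j`-block disjoint from `Ω_j`, `1 ≤ j < i`, `j ≤ k`
  have hblock : ∀ j, 1 ≤ j → j < i → j ≤ k → ∀ (Y : Site P j), embIter j Y ∉ maxDomT M₁ Z j →
      ∀ u u' : Site P 0, iterBlockOf j u = Y → iterBlockOf j u' = Y → T u = T u' := by
    intro j hj1 hji hjk Y hY u u' hu hu'
    refine blockConst_of_adjacent (hjk.trans hkK) Y T (fun x ν hx hxν => ?_) hu hu'
    exact ih j hji x ν (findGreatest_lt_of_block_disjoint hM hkK hdiv hj1 hjk hY hx) (findGreatest_lt_of_block_disjoint hM hkK hdiv hj1 hjk hY hxν)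
  set a := Nat.findGreatest (fun i => z ∈ maxDomT M₁ Z i) k with ha
  set a' := Nat.findGreatest (fun i => z.shift μ ∈ maxDomT M₁ Z i) k with ha'
  have hak : a ≤ k := Nat.findGreatest_le k
  have ha'k : a' ≤ k := Nat.findGreatest_le k
  have htop : iterBlockOf a z ∈ (Bj M₁ Z k : DetSet P) a := iterBlockOf_mem_Bj_of_findGreatest_eq hM hk hkK hdiv z ha.symm
  have htop' : iterBlockOf a' (z.shift μ) ∈ (Bj M₁ Z k : DetSet P) a' := iterBlockOf_mem_Bj_of_findGreatest_eq hM hk hkK hdiv (z.shift μ) ha'.symm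
  rcases lt_trichotomy a a' with hlt | heq | hgt
  · -- `a < a'`: the `a'`-block `Y` of `z` is disjoint from `Ω_{a'}` and the member block of `z + e_μ` is `Y + e_μ`
    have ha'1 : 1 ≤ a' := by omega
    have hzout : z ∉ maxDomT M₁ Z a' := not_mem_maxDomT_of_findGreatest_lt z ha.symm hlt ha'k
    have hY : embIter a' (iterBlockOf a' z) ∉ maxDomT M₁ Z a' := fun h =>
      hzout ((mem_iff_centre_mem (isBlockUnion_maxDomT hM hdiv ha'1 ha'k (ha'k.trans hkK)) z).2 h)
    have hY'in : embIter a' (iterBlockOf a' (z.shift μ)) ∈ maxDomT M₁ Z a' := embIter_mem_maxDomT_of_mem_Bj ha'1 ha'k htop'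
    have hadj : iterBlockOf a' (z.shift μ) = (iterBlockOf a' z).shift μ := (iterBlockOf_shift_or a' (ha'k.trans hkK) z μ).resolve_left fun h => absurd (h ▸ hY'in) hY
    have hbond : (⟨iterBlockOf a' z, μ⟩ : PBond P a') ∈ bondsOf ((Bj M₁ Z k : DetSet P) a') := Or.inr (show (iterBlockOf a' z).shift μ ∈ _ by rw [← hadj]; exact htop')
    calc T (z.shift μ) = ψ (embIter a' (iterBlockOf a' (z.shift μ))) := T_eq_of_findGreatest_eq ψ T hT _ ha'.symm
      _ = ψ (embIter a' (iterBlockOf a' z)) := by rw [hadj]; exact hψ a' ha'k _ hbond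
      _ = T (embIter a' (iterBlockOf a' z)) := (T_centre_of_block_disjoint hM hkK hdiv ψ T hT ha'1 ha'k hY).symm
      _ = T z := hblock a' ha'1 hz'i ha'k (iterBlockOf a' z) hY _ _ (iterBlockOf_embIter a' (ha'k.trans hkK) _) rfl
  · -- `a = a'`: the two member blocks are equal or adjacent
    have hT' : T (z.shift μ) = ψ (embIter a (iterBlockOf a (z.shift μ))) := T_eq_of_findGreatest_eq ψ T hT _ (ha'.symm.trans heq.symm)
    rw [hT', T_eq_of_findGreatest_eq ψ T hT z ha.symm]
    rcases iterBlockOf_shift_or a (hak.trans hkK) z μ with h | h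
    · rw [h]
    · rw [h]
      exact hψ a hak ⟨iterBlockOf a z, μ⟩ (Or.inl htop)
  · -- `a' < a`: symmetric to the first case
    have ha1 : 1 ≤ a := by omega
    have hz'out : z.shift μ ∉ maxDomT M₁ Z a := not_mem_maxDomT_of_findGreatest_lt (z.shift μ) ha'.symm hgt hak
    have hY' : embIter a (iterBlockOf a (z.shift μ)) ∉ maxDomT M₁ Z a := fun h =>
      hz'out ((mem_iff_centre_mem (isBlockUnion_maxDomT hM hdiv ha1 hak (hak.trans hkK)) (z.shift μ)).2 h)
    have hYin : embIter a (iterBlockOf a z) ∈ maxDomT M₁ Z a := embIter_mem_maxDomT_of_mem_Bj ha1 hak htop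
    have hadj : iterBlockOf a (z.shift μ) = (iterBlockOf a z).shift μ := (iterBlockOf_shift_or a (hak.trans hkK) z μ).resolve_left fun h => absurd (h ▸ hYin) hY'
    have hbond : (⟨iterBlockOf a z, μ⟩ : PBond P a) ∈ bondsOf ((Bj M₁ Z k : DetSet P) a) := Or.inl htop
    calc T (z.shift μ) = T (embIter a (iterBlockOf a (z.shift μ))) :=
          hblock a ha1 hzi hak (iterBlockOf a (z.shift μ)) hY' _ _ rfl (iterBlockOf_embIter a (hak.trans hkK) _)
      _ = ψ (embIter a (iterBlockOf a (z.shift μ))) := T_centre_of_block_disjoint hM hkK hdiv ψ T hT ha1 hak hY'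
      _ = ψ (embIter a (iterBlockOf a z)) := by rw [hadj]; exact hψ a hak _ hbond
      _ = T z := (T_eq_of_findGreatest_eq ψ T hT z ha.symm).symm

end Main

/-! ## §5 ★★★ Letter (C) for `𝐁_k(Z)` -/

section Letter

variable {V : Type*} [AddCommGroup V] {M₁ : ℕ} {Z : Set (Site P 0)} {k : ℕ}

/-- ★★★ **LETTER (C) FOR THE RECORD's `𝐁_k(Z)`** (the `hconn` hypothesis of `N12FlatFibreNullSpaceDetSet.exists_constrGauge_of_plaq_eq_zero_of_iterLin_eq_zero_detSet` and of
`N12FlatHierAxialHndDetSet.grad_eq_zero_of_hierAxial_of_locConst`, at `𝐁 = Bj M₁ Z k`): a fine site function constant along every constrained bond of `𝐁_k(Z)` (read at the `j`-fold centres, levels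
`j ≤ k`) takes ONE value at the sources of any two constrained bonds — the potential `T(z) = ψ(top of z)` is continuous across every fine bond (`T_shift_eq`), hence constant on the torus, and every
constrained source value of `ψ` is a value of `T`.  Hypotheses: `1 ≤ M₁`, `1 ≤ k ≤ m + K`, cover divisibility `L^k·M₁ ∣ sitesPerDir 0`. [cite: Balaban1988Convergent, (2.2) p.255, (2.13) pp.256-257] -/
theorem hconn_Bj (hM : 1 ≤ M₁) (hk : 1 ≤ k) (hkK : k ≤ P.m + P.K) (hdiv : side P.L M₁ k ∣ P.sitesPerDir 0) (ψ : Site P 0 → V)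
    (hψ : ∀ j, j ≤ k → ∀ c ∈ bondsOf ((Bj M₁ Z k : DetSet P) j), ψ (embIter j c.tgt) = ψ (embIter j c.src)) :
    ∀ j j', j ≤ k → j' ≤ k → ∀ c ∈ bondsOf ((Bj M₁ Z k : DetSet P) j), ∀ c' ∈ bondsOf ((Bj M₁ Z k : DetSet P) j'),
      ψ (embIter j c.src) = ψ (embIter j' c'.src) := by
  -- the potential `T(z) = ψ(centre of the top of z)`
  obtain ⟨T, hT⟩ : ∃ T : Site P 0 → V, ∀ z, T z = ψ (embIter (Nat.findGreatest (fun i => z ∈ maxDomT M₁ Z i) k)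
      (iterBlockOf (Nat.findGreatest (fun i => z ∈ maxDomT M₁ Z i) k) z)) := ⟨_, fun _ => rfl⟩
  -- `T` is constant on the torus
  have hconst : ∀ z z' : Site P 0, T z = T z' := by
    have h := N12FlatFibreNullSpace.const_of_shift_eq T fun z μ =>
      T_shift_eq hM hk hkK hdiv ψ T hT hψ (k + 1) z μ (Nat.lt_succ_of_le (Nat.findGreatest_le k)) (Nat.lt_succ_of_le (Nat.findGreatest_le k))
    exact fun z z' => (h z).trans (h z').symm
  -- every constrained source value is a value of `T`
  have hsrc : ∀ j, j ≤ k → ∀ c ∈ bondsOf ((Bj M₁ Z k : DetSet P) j), ∃ z, ψ (embIter j c.src) = T z := by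
    intro j hj c hc
    rcases hc with h | h
    · exact ⟨embIter j c.src, (T_embIter_of_mem_Bj hM hk hkK ψ T hT hj h).symm⟩
    · exact ⟨embIter j c.tgt, by rw [← hψ j hj c (Or.inr h)]; exact (T_embIter_of_mem_Bj hM hk hkK ψ T hT hj h).symm⟩
  intro j j' hj hj' c hc c' hc'
  obtain ⟨z, hz⟩ := hsrc j hj c hc
  obtain ⟨z', hz'⟩ := hsrc j' hj' c' hc'
  rw [hz, hz', hconst z z']

end Letter

/-! ## §6 The flat real `hnondeg` letter on the `𝐁_k(Z)`-adapted hierarchical axial slice, geometric letters discharged -/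

section Assembled

open scoped Matrix.Norms.L2Operator Topology
open T4Continuum (T4Family)
open BlockAveragingEMLLinearised (linAvg)
open T4AdjointCovarianceUnitary (lieSU)
open B10Eq27TorusAxialLog (axialT)
open Node00

variable {F : T4Family} {N : ℕ} [NeZero N] {K k : ℕ}

/-- ★★ **THE LETTER `hnondeg` AT THE FLAT BASE FIELD, REAL FORM, ON THE `𝐁_k(Z)`-ADAPTED HIERARCHICAL AXIAL SLICE — GEOMETRIC LETTERS DISCHARGED**: `N12FlatHndRecordLetters.hnondeg_real_flat_hierAxial_detSet`
at the record's `𝐁 = Bj M₁ Z k` with (L) from `hloop_Bj_of_line_misses` (one lattice line per direction misses `Z`), (Cov) from `hcov_Bj`, (C) from `hconn_Bj`.  Still DISPLAYED: the kernel letter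
`hker`, the bilinear flat-Hessian hypothesis `hq`, the `Q`-recursion data `hQ0`∕`hQs`; flat base field only.
[cite: Balaban1989LargeFieldII, (1.9) p.358, p.359; Balaban1988Convergent, (2.2) p.255, (2.13) pp.256-257] -/
theorem hnondeg_real_flat_hierAxial_Bj (hk : k ≤ (F.P K).m + (F.P K).K) (hk1 : 1 ≤ k) {M₁ : ℕ} (hM : 1 ≤ M₁) {Z : Set (Site (F.P K) 0)}
    (hdiv : side (F.P K).L M₁ k ∣ (F.P K).sitesPerDir 0)
    (hline : ∀ μ : Fin (F.P K).d, ∃ a : Site (F.P K) 0, ∀ y : Site (F.P K) 0, (∀ ν, ν ≠ μ → y ν = a ν) → y ∉ Z)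
    (Q : (i : ℕ) → (PBond (F.P K) 0 → Matrix (Fin N) (Fin N) ℂ) → PBond (F.P K) i → Matrix (Fin N) (Fin N) ℂ)
    (hQ0 : ∀ Y, Q 0 Y = Y) (hQs : ∀ (i : ℕ) (Y : PBond (F.P K) 0 → Matrix (Fin N) (Fin N) ℂ) (c : PBond (F.P K) (i + 1)), Q (i + 1) Y c = linAvg (Q i Y) c)
    (s : PBond (F.P K) 0 → lieSU (Fin N))
    (hs : ∀ j, j ≤ k → ∀ y ∈ (Bj M₁ Z k : DetSet (F.P K)) j, ∀ m, m < j → ∀ x : Site (F.P K) m, iterBlockOf j (embIter m x) = y →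
      axialT (fun b : PBond (F.P K) m => Multiplicative.ofAdd (Q m (fun e => (s e : Matrix (Fin N) (Fin N) ℂ)) b)) (emb (blockOf x)) x = 1)
    (hker : fderiv ℝ (msChart F N K k (Bj M₁ Z k) (avgFamily (avOfRecord F N K) (1 : GaugeField (F.P K) 0 (SU N))) (1 : GaugeField (F.P K) 0 (SU N))) 0 s = 0)
    (hq : ∀ t : PBond (F.P K) 0 → lieSU (Fin N),
      (∀ j, j ≤ k → ∀ y ∈ (Bj M₁ Z k : DetSet (F.P K)) j, ∀ m, m < j → ∀ x : Site (F.P K) m, iterBlockOf j (embIter m x) = y →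
        axialT (fun b : PBond (F.P K) m => Multiplicative.ofAdd (Q m (fun e => (t e : Matrix (Fin N) (Fin N) ℂ)) b)) (emb (blockOf x)) x = 1) →
      fderiv ℝ (msChart F N K k (Bj M₁ Z k) (avgFamily (avOfRecord F N K) (1 : GaugeField (F.P K) 0 (SU N))) (1 : GaugeField (F.P K) 0 (SU N))) 0 t = 0 →
      fderiv ℝ (fun Y => fderiv ℝ (fun Y : PBond (F.P K) 0 → lieSU (Fin N) => wilsonAction4 (expChart (1 : GaugeField (F.P K) 0 (SU N)) Y)) Y) 0 s t = 0) :
    s = 0 :=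
  N12FlatHndRecordLetters.hnondeg_real_flat_hierAxial_detSet hk Q hQ0 hQs (Bj M₁ Z k)
    (N12FlatHndRecordLetters.hloop_Bj_of_line_misses hM hk1 hline) (N12FlatHndRecordLetters.hcov_Bj hM hk1 hk hdiv)
    (hconn_Bj hM hk1 hk hdiv) s hs hker hq

end Assembled

end Summit.QuantumFields.YangMills.BalabanUVNodes.N12FlatHndConnLetter

end
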